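import Summits.RiemannHypothesis.RiemannHypothesis.Theorems.MotivicDoorFfHodgeSignature

/-!
# Motivic door, ff calibration: RANK AND NULLITY of the window form, the real lattice form and the formal
Néron–Severi form — `rk T_M = rk S_M = r`, `n₀ = M + 1 − r`, `rk G_M = r + 2`, `r = min(M + 1, D)`
(pub-rhdoor, unit `ffcal`, HOME/FFCAL.md §0 A4; seat planner-pub-rhdoor-ffcal-g5-0)

HONEST FRAMING (cell charter, verbatim): lottery ticket at the motivic door; RH probability negligible;
consolation prizes are real: a new semi-local Weil-positivity theorem, or a located gap in the
Connes–Consani programme, plus the ff-door theorem.  Nothing in this file is a statement about `ζ`.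

WORK TYPE: new formalisation of [folklore] linear algebra (the rank of a Vandermonde-type Gram form with
finitely atomic symbol = the number of atoms), binding BY NAME to the tree's window form
`T_M(q,h) = weilWindowForm q h M` (`PfPersistenceFfAngleTwin`), the real lattice form
`S_M = realLattice q h M = D (2T_M) D` (`MotivicDoorFfRealLattice`) and the formal Néron–Severi Gram matrix
`G_M = nsGram q h M` on `{H, V, Γ_0, …, Γ_M}` (`MotivicDoorFfHodgeIndex`).  Together with its sequel
`MotivicDoorFfInertia` (eigenvalue sign counts) it closes the one entry of FFCAL.md §0 A4 that was still
CERTIFIED DATA rather than a theorem: the COUNTS of the inertia triple `(n₊, n₀, n₋) = (1, M + 1 − r, 1 + r)`.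
No RH claim in either direction; for `h` the `L`-polynomial of a curve, RH(q,h) is Weil's theorem and every
statement below is then unconditional [folklore: Weil 1948; Hartshorne GTM 52 Ex. V.1.9–1.10; the rank of
a positive semidefinite Toeplitz matrix with finitely atomic symbol, cf. Hallouin–Perret, Trans. AMS 372
(2019) App. A].

Throughout `D := #{distinct complex roots of h}` (`(frobRoots h).toFinset.card`; `= 2g` iff `h` is
squarefree) and `r := min (M + 1) D`.  Under RH(q,h) (`‖α‖ = √q` for every root) and `q > 0`:

* `finrank_eq_of_mem_iff_dvd` (generic, any field): a subspace of coefficient vectors `c ∈ K^{M+1}` cut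
  out by `r ∣ Σ_m c_m X^m` for a monic `r` has dimension `M + 1 − deg r` (multiplication by `r`).
* `finrank_ker_weilWindowForm`, `rank_weilWindowForm`: `dim ker T_M = M + 1 − r`, `rk T_M = r` (the kernel
  is `rad(h̃)·ℂ[z]_{≤ M−D}` by `MotivicDoorFfCliff`); multiset versions `…_ffWindowForm`.
* `exists_real_radical`: the radical `∏_{α distinct}(X − α)` of `h` has REAL coefficients (conjugation
  permutes the distinct roots), so it descends to a monic `r ∈ ℝ[X]` of degree `D`;
  `realLattice_mulVec_eq_zero_iff_dvd`: `S_M c = 0 ↔ r ∣ Σ c_m X^m` in `ℝ[X]`;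
  `finrank_ker_realLattice`, `rank_realLattice`: `dim_ℝ ker S_M = M + 1 − r`, `rk S_M = r`.
* `finrank_ker_nsGram`, `rank_nsGram`: the radical of the formal Néron–Severi form (= the classes with
  `x·H = x·V = 0`, `S_M c = 0`, `MotivicDoorFfHodgeSignature.nsGram_mulVec_eq_zero_iff`) is linearly
  isomorphic to `ker S_M`: `n₀ = dim rad G_M = M + 1 − r`, `rk G_M = r + 2`.

DATA context (not used in any proof): FFCAL.md §0 A4 — blind inertia `(1, M+1−r, 1+r)` CERTIFIED by exact
integer `LDLᵀ` on 221/221 windows of the panels G*∪N and 2195/2195 census windows (= pub-weilobs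
`x_ff.hodge` on 328/328); the `n₀` and rank columns of that table are PROVED here.
-/

set_option linter.dupNamespace false  -- the mandated namespace repeats `RiemannHypothesis`

noncomputable section

open Polynomial Matrix Finset
open scoped ComplexOrder ComplexConjugate

namespace Summit.RiemannHypothesis.RiemannHypothesis.Theorems.MotivicDoor.FfRank

open Summit.RiemannHypothesis.RiemannHypothesis.Theorems.PfPersistence.FfAngleTwin
open Summit.RiemannHypothesis.RiemannHypothesis.Theorems.MotivicDoor.FfRealLattice
open Summit.RiemannHypothesis.RiemannHypothesis.Theorems.MotivicDoor.FfCliff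
open Summit.RiemannHypothesis.RiemannHypothesis.Theorems.MotivicDoor.FfHodgeIndex
open Summit.RiemannHypothesis.RiemannHypothesis.Theorems.MotivicDoor.FfHodgeSignature

/-! ## Generic linear algebra: coefficient vectors of the multiples of a monic polynomial -/

section Generic

variable {K : Type*} [Field K]

/-- The `j`-th coefficient of `Σ_{i<N} s_i X^i` is `s_j`. [folklore] -/
theorem coeff_sum_C_mul_X_pow {N : ℕ} (s : Fin N → K) (j : Fin N) :
    (∑ i : Fin N, C (s i) * X ^ (i : ℕ)).coeff (j : ℕ) = s j := by
  rw [finsetSum_coeff]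
  simp only [coeff_C_mul_X_pow]
  rw [Finset.sum_eq_single j, if_pos rfl]
  · intro b _ hb
    rw [if_neg]
    exact fun e => hb (Fin.ext e).symm
  · intro hj; exact absurd (Finset.mem_univ j) hj

/-- A polynomial of degree `< N` is the sum of its first `N` monomials. [folklore] -/
theorem eq_sum_C_mul_X_pow_of_natDegree_lt {N : ℕ} {p : K[X]} (hp : p.natDegree < N) :
    p = ∑ i : Fin N, C (p.coeff i) * X ^ (i : ℕ) := by
  conv_lhs => rw [as_sum_range' p N hp]
  rw [Fin.sum_univ_eq_sum_range (fun i => C (p.coeff i) * X ^ i) N]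
  simp only [C_mul_X_pow_eq_monomial]

/-- Vanishing at every point of a finite multiset `S ⊂ K` is divisibility by the RADICAL
`∏_{w ∈ S distinct}(X - w)`. [folklore] -/
theorem forall_eval_eq_zero_iff_radical_dvd [DecidableEq K] (S : Multiset K) (p : K[X]) :
    (∀ z ∈ S, p.eval z = 0) ↔ (S.dedup.map fun w => X - C w).prod ∣ p := by
  by_cases hp : p = 0
  · exact iff_of_true (fun z _ => by rw [hp, eval_zero]) (by rw [hp]; exact dvd_zero _)
  · rw [Multiset.prod_X_sub_C_dvd_iff_le_roots hp, Multiset.le_iff_subset (Multiset.nodup_dedup _)]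
    constructor
    · intro h z hz
      exact (mem_roots hp).2 (IsRoot.def.2 (h z (Multiset.mem_dedup.1 hz)))
    · intro h z hz
      exact IsRoot.def.1 ((mem_roots hp).1 (h (Multiset.mem_dedup.2 hz)))

/-- **Dimension of the multiples of a monic polynomial inside the coefficient vectors of length `M + 1`.**
If a subspace `W ⊆ K^{M+1}` is cut out by `r ∣ Σ_m c_m X^m` with `r` monic of degree `D`, then
`dim W = M + 1 − D` (truncated subtraction): `s ↦` coefficients of `(Σ_{j < M+1−D} s_j X^j) · r` is a linear
bijection `K^{M+1−D} → W`. [folklore] -/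
theorem finrank_eq_of_mem_iff_dvd {M : ℕ} {r : K[X]} (hr : r.Monic) (W : Submodule K (Fin (M + 1) → K))
    (hW : ∀ c, c ∈ W ↔ r ∣ ∑ m : Fin (M + 1), C (c m) * X ^ (m : ℕ)) :
    Module.finrank K W = M + 1 - r.natDegree := by
  set D := r.natDegree with hD
  set N := M + 1 - D with hN
  let tp : (Fin N → K) → K[X] := fun s => ∑ j : Fin N, C (s j) * X ^ (j : ℕ)
  have tp_add : ∀ s t, tp (s + t) = tp s + tp t := fun s t => by
    simp only [tp, Pi.add_apply, C_add, add_mul, Finset.sum_add_distrib]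
  have tp_smul : ∀ (a : K) (s), tp (a • s) = C a * tp s := fun a s => by
    simp only [tp, Pi.smul_apply, smul_eq_mul, C_mul, mul_assoc, Finset.mul_sum]
  let Φ : (Fin N → K) →ₗ[K] (Fin (M + 1) → K) :=
    { toFun := fun s m => (tp s * r).coeff m
      map_add' := fun s t => by
        funext m; simp only [tp_add, add_mul, coeff_add, Pi.add_apply]
      map_smul' := fun a s => by
        funext m; simp only [tp_smul, mul_assoc, coeff_C_mul, Pi.smul_apply, smul_eq_mul,
          RingHom.id_apply] }
  have hΦ : ∀ s m, Φ s m = (tp s * r).coeff m := fun s m => rfl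
  -- degrees
  have hdeg : ∀ s, (tp s * r).natDegree ≤ M := by
    intro s
    by_cases h0 : tp s = 0
    · rw [h0, zero_mul, natDegree_zero]; exact Nat.zero_le _
    · have h1 : (tp s).natDegree < N := (natDegree_lt_iff_degree_lt h0).2 (degree_sum_fin_lt s)
      have h2 := natDegree_mul_le (p := tp s) (q := r)
      omega
  have hΦtp : ∀ s, (∑ m : Fin (M + 1), C (Φ s m) * X ^ (m : ℕ)) = tp s * r := fun s =>
    (eq_sum_C_mul_X_pow_of_natDegree_lt (Nat.lt_succ_of_le (hdeg s))).symm
  -- Φ is injective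
  have hinj : Function.Injective Φ := by
    rw [← LinearMap.ker_eq_bot, LinearMap.ker_eq_bot']
    intro s hs
    have hP : tp s * r = 0 := by
      rw [← hΦtp s]
      exact Finset.sum_eq_zero fun m _ => by rw [hs, Pi.zero_apply, C_0, zero_mul]
    have htp : tp s = 0 := (mul_eq_zero.1 hP).resolve_right hr.ne_zero
    funext j
    have e := coeff_sum_C_mul_X_pow s j
    rw [show (∑ i : Fin N, C (s i) * X ^ (i : ℕ)) = tp s from rfl, htp, coeff_zero] at e
    exact e.symm
  -- its range is `W`
  have hrange : LinearMap.range Φ = W := by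
    apply le_antisymm
    · rintro c ⟨s, rfl⟩
      rw [hW, hΦtp]
      exact dvd_mul_left r (tp s)
    · intro c hc
      rw [hW] at hc
      obtain ⟨t, ht⟩ := hc
      by_cases ht0 : t = 0
      · have hc0 : c = 0 := by
          funext m
          have e := coeff_sum_C_mul_X_pow c m
          rw [ht, ht0, mul_zero, coeff_zero] at e
          exact e.symm
        rw [hc0]; exact zero_mem _
      · have hdt : t.natDegree < N := by
          have h1 : (∑ m : Fin (M + 1), C (c m) * X ^ (m : ℕ)).natDegree < M + 1 := by
            by_cases hp0 : (∑ m : Fin (M + 1), C (c m) * X ^ (m : ℕ)) = 0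
            · rw [hp0, natDegree_zero]; exact Nat.succ_pos M
            · exact (natDegree_lt_iff_degree_lt hp0).2 (degree_sum_fin_lt c)
          rw [ht, natDegree_mul hr.ne_zero ht0] at h1
          omega
        refine ⟨fun j => t.coeff j, ?_⟩
        have htp : tp (fun j : Fin N => t.coeff j) = t :=
          (eq_sum_C_mul_X_pow_of_natDegree_lt hdt).symm
        funext m
        rw [hΦ, htp, mul_comm, ← ht, coeff_sum_C_mul_X_pow]
  rw [← hrange, LinearMap.finrank_range_of_inj hinj, Module.finrank_fin_fun]

end Generic

/-! ## Rank and nullity of the window form `T_M` -/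

/-- **NULLITY OF THE WINDOW FORM** (RH-true real datum, every multiplicity pattern):
`dim ker T_M(q, A) = M + 1 − D`, `D` the number of distinct normalised roots. [folklore] -/
theorem finrank_ker_ffWindowForm {q : ℝ} {A : Multiset ℂ} (hmod : ∀ z ∈ normRoots q A, ‖z‖ = 1)
    (hconj : (normRoots q A).map conj = normRoots q A) (M : ℕ) :
    Module.finrank ℂ (LinearMap.ker (ffWindowForm q A M).mulVecLin)
      = M + 1 - (normRoots q A).toFinset.card := by
  have hmonic : ((normRoots q A).dedup.map fun w => X - C w).prod.Monic :=
    monic_multiset_prod_of_monic _ _ fun w _ => monic_X_sub_C w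
  have hnat : ((normRoots q A).dedup.map fun w => X - C w).prod.natDegree
      = (normRoots q A).toFinset.card := by
    rw [natDegree_multiset_prod_X_sub_C_eq_card, card_dedup_eq_toFinset_card]
  rw [← hnat]
  exact finrank_eq_of_mem_iff_dvd hmonic _ fun c => by
    rw [LinearMap.mem_ker, mulVecLin_apply, ffWindowForm_mulVec_eq_zero_iff_radical_dvd hmod hconj]

/-- **RANK OF THE WINDOW FORM**: `rk T_M(q, A) = min(M + 1, D)`. [folklore] -/
theorem rank_ffWindowForm {q : ℝ} {A : Multiset ℂ} (hmod : ∀ z ∈ normRoots q A, ‖z‖ = 1)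
    (hconj : (normRoots q A).map conj = normRoots q A) (M : ℕ) :
    (ffWindowForm q A M).rank = min (M + 1) (normRoots q A).toFinset.card := by
  have h1 := LinearMap.finrank_range_add_finrank_ker (ffWindowForm q A M).mulVecLin
  rw [Module.finrank_fin_fun, finrank_ker_ffWindowForm hmod hconj] at h1
  unfold Matrix.rank
  omega

/-- NULLITY for the datum `(q, h)`: RH(q,h) ⇒ `dim ker T_M(q, h) = M + 1 − D`,
`D = #{distinct complex roots of h}`. [folklore] -/
theorem finrank_ker_weilWindowForm {q : ℝ} (hq : 0 < q) {h : ℤ[X]}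
    (hRH : ∀ α ∈ frobRoots h, ‖α‖ = Real.sqrt q) (M : ℕ) :
    Module.finrank ℂ (LinearMap.ker (weilWindowForm q h M).mulVecLin)
      = M + 1 - (frobRoots h).toFinset.card := by
  rw [← toFinset_card_normRoots hq]
  exact finrank_ker_ffWindowForm (normRoots_norm_eq_one hq hRH) (normRoots_frobRoots_map_conj q h) M

/-- **RANK for the datum `(q, h)`**: RH(q,h) ⇒ `rk T_M(q, h) = min(M + 1, D)` — FFCAL's `r`. [folklore] -/
theorem rank_weilWindowForm {q : ℝ} (hq : 0 < q) {h : ℤ[X]}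
    (hRH : ∀ α ∈ frobRoots h, ‖α‖ = Real.sqrt q) (M : ℕ) :
    (weilWindowForm q h M).rank = min (M + 1) (frobRoots h).toFinset.card := by
  rw [← toFinset_card_normRoots hq]
  exact rank_ffWindowForm (normRoots_norm_eq_one hq hRH) (normRoots_frobRoots_map_conj q h) M

/-! ## The real side: the radical of `h` is a real polynomial; rank and nullity of `S_M` -/

variable (q : ℕ) (h : ℤ[X]) (M : ℕ)

/-- **THE RADICAL OF `h` IS REAL**: `∏_{α distinct root of h}(X − α) ∈ ℂ[X]` is fixed by coefficientwise
conjugation (conjugation permutes the distinct roots of an integer polynomial), hence is the image of a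
monic `r ∈ ℝ[X]` of degree `D`. [folklore] -/
theorem exists_real_radical (h : ℤ[X]) :
    ∃ r : ℝ[X], r.map Complex.ofRealHom = ((frobRoots h).dedup.map fun w => X - C w).prod
      ∧ r.natDegree = (frobRoots h).toFinset.card ∧ r.Monic := by
  set rad := ((frobRoots h).dedup.map fun w => X - C w).prod with hrad
  have hmonic : rad.Monic := monic_multiset_prod_of_monic _ _ fun w _ => monic_X_sub_C w
  have hnat : rad.natDegree = (frobRoots h).toFinset.card := by
    rw [hrad, natDegree_multiset_prod_X_sub_C_eq_card, card_dedup_eq_toFinset_card]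
  have hfix : rad.map (starRingEnd ℂ) = rad := by
    rw [hrad, Polynomial.map_multiset_prod, Multiset.map_map]
    have e : ((fun p : ℂ[X] => p.map (starRingEnd ℂ)) ∘ fun w : ℂ => X - C w)
        = (fun w : ℂ => X - C w) ∘ (starRingEnd ℂ) := by
      funext w; simp [Polynomial.map_sub, map_X, map_C]
    rw [e, ← Multiset.map_map, ← Multiset.dedup_map_of_injective (starRingEnd ℂ).injective,
      frobRoots_map_conj]
  have hlifts : rad ∈ Polynomial.lifts Complex.ofRealHom := by
    rw [lifts_iff_coeff_lifts]
    intro n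
    have hn : conj (rad.coeff n) = rad.coeff n := by
      conv_rhs => rw [← hfix]
      rw [coeff_map]
    obtain ⟨x, hx⟩ := Complex.conj_eq_iff_real.1 hn
    exact ⟨x, hx.symm⟩
  obtain ⟨r, hr, hdeg, hm⟩ := lifts_and_natDegree_eq_and_monic hlifts hmonic
  exact ⟨r, hr, hdeg.trans hnat, hm⟩

/-- `S_M c = 0 ↔ r ∣ Σ_m c_m X^m` in `ℝ[X]`, for the real radical `r` of `h` (RH(q,h), `q ≥ 1`):
the kernel of the real lattice form is the coefficient vectors of the real multiples of the radical.
[folklore] -/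
theorem realLattice_mulVec_eq_zero_iff_dvd (hq : 0 < q) (hRH : ∀ α ∈ frobRoots h, ‖α‖ = Real.sqrt q)
    {r : ℝ[X]} (hr : r.map Complex.ofRealHom = ((frobRoots h).dedup.map fun w => X - C w).prod)
    (c : Fin (M + 1) → ℝ) :
    realLattice q h M *ᵥ c = 0 ↔ r ∣ ∑ m : Fin (M + 1), C (c m) * X ^ (m : ℕ) := by
  rw [realLattice_mulVec_eq_zero_iff_frob q h M hq hRH]
  have hmap : (∑ m : Fin (M + 1), C (c m) * X ^ (m : ℕ)).map Complex.ofRealHom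
      = ∑ m : Fin (M + 1), C ((c m : ℂ)) * X ^ (m : ℕ) := by
    rw [Polynomial.map_sum]
    simp only [Polynomial.map_mul, Polynomial.map_pow, map_C, map_X, Complex.ofRealHom_eq_coe]
  rw [← map_dvd_map' Complex.ofRealHom, hr, hmap, ← forall_eval_eq_zero_iff_radical_dvd]
  refine forall₂_congr fun α _ => ?_
  rw [eval_finsetSum]
  simp only [eval_mul, eval_C, eval_pow, eval_X]

/-- **NULLITY OF THE REAL LATTICE FORM**: RH(q,h) ⇒ `dim_ℝ ker S_M = M + 1 − D`. [folklore] -/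
theorem finrank_ker_realLattice (hq : 0 < q) (hRH : ∀ α ∈ frobRoots h, ‖α‖ = Real.sqrt q) :
    Module.finrank ℝ (LinearMap.ker (realLattice q h M).mulVecLin)
      = M + 1 - (frobRoots h).toFinset.card := by
  obtain ⟨r, hr, hdeg, hm⟩ := exists_real_radical h
  rw [← hdeg]
  exact finrank_eq_of_mem_iff_dvd hm _ fun c => by
    rw [LinearMap.mem_ker, mulVecLin_apply, realLattice_mulVec_eq_zero_iff_dvd q h M hq hRH hr]

/-- **RANK OF THE REAL LATTICE FORM**: RH(q,h) ⇒ `rk S_M = min(M + 1, D)`. [folklore] -/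
theorem rank_realLattice (hq : 0 < q) (hRH : ∀ α ∈ frobRoots h, ‖α‖ = Real.sqrt q) :
    (realLattice q h M).rank = min (M + 1) (frobRoots h).toFinset.card := by
  have h1 := LinearMap.finrank_range_add_finrank_ker (realLattice q h M).mulVecLin
  rw [Module.finrank_fin_fun, finrank_ker_realLattice q h M hq hRH] at h1
  unfold Matrix.rank
  omega

/-! ## The radical of the formal Néron–Severi form: `n₀ = M + 1 − r`, `rk G_M = r + 2` -/

/-- **NULLITY OF THE NÉRON–SEVERI FORM** (`n₀`): RH(q,h) ⇒ the radical of `G_M = nsGram q h M` has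
dimension `M + 1 − D` (truncated), i.e. `M + 1 − r`: restriction to the `Γ`-coordinates is a linear
isomorphism `rad G_M ≅ ker S_M` (`nsGram_mulVec_eq_zero_iff`: a null class has `x·H = x·V = 0`, which
determines its `H`- and `V`-coefficients from `c`). [folklore] -/
theorem finrank_ker_nsGram (hq : 0 < q) (hRH : ∀ α ∈ frobRoots h, ‖α‖ = Real.sqrt q) :
    Module.finrank ℝ (LinearMap.ker (nsGram q h M).mulVecLin)
      = M + 1 - (frobRoots h).toFinset.card := by
  let π : (NSIndex M → ℝ) →ₗ[ℝ] (Fin (M + 1) → ℝ) := LinearMap.funLeft ℝ ℝ Sum.inr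
  have hπ : ∀ x ∈ LinearMap.ker (nsGram q h M).mulVecLin,
      π x ∈ LinearMap.ker (realLattice q h M).mulVecLin := by
    intro x hx
    rw [LinearMap.mem_ker, mulVecLin_apply] at hx ⊢
    exact ((nsGram_mulVec_eq_zero_iff q h M x).1 hx).2.2
  have hbij : Function.Bijective (π.restrict hπ) := by
    constructor
    · rw [injective_iff_map_eq_zero]
      rintro ⟨x, hx⟩ h0
      have h0' : ∀ m, x (Sum.inr m) = 0 := fun m => by
        have e := congr_arg (fun v : LinearMap.ker (realLattice q h M).mulVecLin =>
          (v : Fin (M + 1) → ℝ) m) h0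
        simpa [π, LinearMap.restrict_apply] using e
      rw [LinearMap.mem_ker, mulVecLin_apply, nsGram_mulVec_eq_zero_iff, degH_eq, degV_eq] at hx
      obtain ⟨hH, hV, -⟩ := hx
      simp only [h0', mul_zero, Finset.sum_const_zero, add_zero] at hH hV
      refine Subtype.ext (funext fun i => ?_)
      rcases i with i | m
      · fin_cases i
        · exact hV
        · exact hH
      · exact h0' m
    · rintro ⟨c, hc⟩
      rw [LinearMap.mem_ker, mulVecLin_apply] at hc
      let x : NSIndex M → ℝ :=
        Sum.elim ![-(∑ m : Fin (M + 1), (q : ℝ) ^ (m : ℕ) * c m), -(∑ m : Fin (M + 1), c m)] c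
      have hx : x ∈ LinearMap.ker (nsGram q h M).mulVecLin := by
        rw [LinearMap.mem_ker, mulVecLin_apply, nsGram_mulVec_eq_zero_iff, degH_eq, degV_eq]
        refine ⟨?_, ?_, ?_⟩
        · simp [x]
        · simp [x]
        · simpa [x] using hc
      exact ⟨⟨x, hx⟩, Subtype.ext (funext fun m => rfl)⟩
  rw [← finrank_ker_realLattice q h M hq hRH]
  exact (LinearEquiv.ofBijective _ hbij).finrank_eq

/-- **RANK OF THE NÉRON–SEVERI FORM**: RH(q,h) ⇒ `rk G_M = r + 2` (`G_M` is `(M + 3) × (M + 3)`).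
[folklore] -/
theorem rank_nsGram (hq : 0 < q) (hRH : ∀ α ∈ frobRoots h, ‖α‖ = Real.sqrt q) :
    (nsGram q h M).rank = min (M + 1) (frobRoots h).toFinset.card + 2 := by
  have h1 := LinearMap.finrank_range_add_finrank_ker (nsGram q h M).mulVecLin
  rw [Module.finrank_fintype_fun_eq_card, Fintype.card_sum, Fintype.card_fin, Fintype.card_fin,
    finrank_ker_nsGram q h M hq hRH] at h1
  unfold Matrix.rank
  omega

end Summit.RiemannHypothesis.RiemannHypothesis.Theorems.MotivicDoor.FfRank

end
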